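import Summits.KontsevichZagierPeriods.KontsevichZagierPeriods.Theses.IsogenyCertificates
import Summits.KontsevichZagierPeriods.KontsevichZagierPeriods.Theorems.IsogenyCertificatesXMapKernelCellsUnconditional
import Summits.KontsevichZagierPeriods.KontsevichZagierPeriods.Theorems.IsogenyCertificatesBiellipticRealPeriodCellStubComponentShape
import Summits.KontsevichZagierPeriods.KontsevichZagierPeriods.Theorems.IsogenyCertificatesBiellipticRealPeriodCellStubInvSqrtIntegrable
import Summits.KontsevichZagierPeriods.KontsevichZagierPeriods.Theorems.IsogenyCertificatesBiellipticRealPeriodCellStubIntegralModels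
import Summits.KontsevichZagierPeriods.KontsevichZagierPeriods.Theorems.IsogenyCertificatesBiellipticRealPeriodCellStubImages
import Summits.KontsevichZagierPeriods.KontsevichZagierPeriods.Theorems.IsogenyCertificatesBiellipticRealPeriodCellStubComponentLanding
import Summits.KontsevichZagierPeriods.KontsevichZagierPeriods.Theorems.IsogenyCertificatesBiellipticRealPeriodCellStubHalfMoves
import Summits.KontsevichZagierPeriods.KontsevichZagierPeriods.Theorems.IsogenyCertificatesBiellipticRealPeriodCellStubAssemblySa
import Literature.NumberTheory.Transcendental.KZCalculus
import Literature.NumberTheory.Transcendental.KZLogCalculusProofs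
import Literature.NumberTheory.Transcendental.KZDominatedFamilyRelations

/-!
# Skeleton — crux `BiellipticRealPeriodCell` (stmt-KontsevichZagierPeriods-18685), line `Sketch`
(= idea `sextic-xmap-data-pushforward`, planner k2; lead prover 0, registration 1, 2026-08-17)

The crux: every value-`0` formal `ℤ`-combination of bielliptic generators `[K, (a₀ + a₁x)/√G(x²)]`
(`G ∈ ℚ[X]` cubic, `F = G(x²)` squarefree, `K` a BOUNDED component of `{F > 0}`) is a KZ relation.

Line (sextic x-map data pushforward): the two quotient maps of the bielliptic involution, composed
with the rational affine normalisation of the elliptic quotients `E₁ : y² = G(u)`, `E₂ : w² = G*(v)`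
(`G* = v³G(1/v)`) onto INTEGRAL short Weierstrass models `P₁, P₂`, are single rule-(2) moves
`φ₁(x) = (x² − s₁)/m₁` (odd part `a₁x dx/√F ↦ ±(a₁|m₁|/2|k₁|) dt/√P₁`) and `φ₂(x) = (x⁻² − s₂)/m₂`
(even part `a₀ dx/√F ↦ (a₀|m₂|/2|k₂|) dt/√P₂`) on each sign-half of `K`; whole components go to whole
components (Weierstrass end points go to roots, `x = 0` goes to `∞` on the `P₂` side), the odd parts
of a central oval cancel formally, and whole components of `{Pᵢ > 0}` are in the span of the LANDED
real-period cell (i) (`XMapKernelCells.realPeriodCellKernel_relations`) by the landed census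
(`stub_cubicComponents`, `stub_unboundedToEgg`). Kernel form transfers along generatorwise
congruences (`kernel_transfer`, proved here).

Registration 1 (lead 0, 2026-08-17 04:40Z): stubs `stub_componentShape` (A), `stub_invSqrtIntegrable` (B),
`stub_integralModels` (C), `stub_halfMoves` (F), `stub_images` (G), `stub_componentLanding` (DE),
`stub_assembly` (ASM: A → B → C → F → G → DE → generatorwise transfer). Wave 1 LANDED A (p142308),
B (p142704), C (p142335), G (p142368), DE (p142910), ASM (p144190 + aux p142841, as `stub_assembly` and
the registered helper `stub_assembly_of_halfMoves`); F came back `stub-misstated`: the source piece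
`O.domain = {x | x 0 ∈ Ioo α β}` forces `ℚ`-semialgebraicity of the half interval, which F's hypotheses
do not give (`G = X³ − X`, `β = π`), so F needs the extra hypothesis
`IsSemialgebraic ℚ {x | x 0 ∈ Ioo α β}` (always available at the four call sites: the halves are
`r.domain ∩ {±x 0 > 0}`).

Registration 2 (this file, RESHAPE): A, B, C, G, DE below are CLOSED (restated verbatim, proved by the
landed theorems); F is re-registered WITH the semialgebraicity hypothesis (`stub_halfMoves`, the worker's
checked proof of exactly this text is being landed); ASM is re-registered in the applied form
`stub_assembly_of_halfMovesSa : F → transfer` (the landed `Assembly.stub_assembly` proof with the extra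
argument threaded through; lead). Composition `BiellipticRealPeriodCell_of` = `kernel_transfer` +
`stub_assembly_of_halfMovesSa stub_halfMoves` + the landed cell (i). Open after registration 2:
{F (proof in hand), ASM-Sa (lead)}.

FINAL STATE (2026-08-17): F LANDED (p144820, `HalfMoves.stub_halfMoves`), ASM-Sa LANDED (p145627,
`Assembly.stub_assembly_of_halfMovesSa`). NO `sorry` remains: the skeleton is the crux proof, landed as
`Theorems/IsogenyCertificatesBiellipticRealPeriodCell.lean`
(`BiellipticRealPeriodCellLine.BiellipticRealPeriodCell_proof`, `--workitem stmt-KontsevichZagierPeriods-18685`).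
-/

noncomputable section

-- work file under `Cruxes/…/Lines`: the prescribed namespace repeats the summit name; silence only that linter.
set_option linter.dupNamespace false

namespace Summit.KontsevichZagierPeriods.KontsevichZagierPeriods.Cruxes.BiellipticRealPeriodCell.Lines.Sketch

open scoped BigOperators
open Polynomial Set MeasureTheory
open Literature.NumberTheory.Transcendental
open Summit.KontsevichZagierPeriods.KontsevichZagierPeriods.Theses.IsogenyCertificates

/-! ### Registered stubs -/

/-- **A — shape of a bounded component of `{G(x²) > 0}`.** A bounded connected component `K` of the
positivity set of the even sextic `F = G(X²)` (squarefree) through a point `q` is an open interval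
`(α, β)` whose end points are roots of `F`; `F(0) ≠ 0`; and if `0 ∈ K` then `K = (−β, β)`. -/
theorem stub_componentShape : ∀ (G : ℚ[X]) (q : ℚ), G.natDegree = 3 → Squarefree (G.comp (X ^ 2)) →
    0 < aeval (q : ℝ) (G.comp (X ^ 2)) →
    Bornology.IsBounded (connectedComponentIn {y : ℝ | 0 < aeval y (G.comp (X ^ 2))} (q : ℝ)) →
    ∃ α β : ℝ, α < β ∧ connectedComponentIn {y : ℝ | 0 < aeval y (G.comp (X ^ 2))} (q : ℝ) = Ioo α β ∧
      aeval α (G.comp (X ^ 2)) = 0 ∧ aeval β (G.comp (X ^ 2)) = 0 ∧ aeval (0 : ℝ) (G.comp (X ^ 2)) ≠ 0 ∧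
      ((0 : ℝ) ∈ Ioo α β → α = -β) :=
  Summit.KontsevichZagierPeriods.IsogenyCertificates.BiellipticRealPeriodCellStubs.ComponentShape.stub_componentShape

/-- **B — `dx/√F` converges on a bounded component.** For a squarefree `F ∈ ℚ[X]`, positive on
`(α, β)` and vanishing at both (simple) end points, `1/√F` is integrable on `(α, β)` (read in `ℝ¹`). -/
theorem stub_invSqrtIntegrable : ∀ (F : ℚ[X]) (α β : ℝ), Squarefree F → α < β →
    aeval α F = 0 → aeval β F = 0 → (∀ y ∈ Ioo α β, 0 < aeval y F) →
    IntegrableOn (fun x : Fin 1 → ℝ => 1 / Real.sqrt (aeval (x 0) F)) {x | x 0 ∈ Ioo α β} :=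
  Summit.KontsevichZagierPeriods.IsogenyCertificates.BiellipticRealPeriodCellStubs.InvSqrtIntegrable.stub_invSqrtIntegrable

/-- **C — integral short-Weierstrass models of the two elliptic quotients.** For `G` cubic with
`G(X²)` squarefree there are rational affine substitutions `u = m₁t + s₁`, `v = m₂t + s₂` and
`k₁, k₂ ∈ ℚˣ`, `(Aᵢ, Bᵢ) ∈ ℤ²` nonsingular, with `G(m₁t + s₁) = k₁²(t³ + A₁t + B₁)` and
`G*(m₂t + s₂) = k₂²(t³ + A₂t + B₂)` (`G*(v) = v³G(1/v)`), stated as the two real identities in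
`y` (`u = y²`, `v = y⁻²`, denominators cleared) that the moves consume. -/
theorem stub_integralModels : ∀ (G : ℚ[X]), G.natDegree = 3 → Squarefree (G.comp (X ^ 2)) →
    (∃ (m s k : ℚ) (A B : ℤ), m ≠ 0 ∧ k ≠ 0 ∧ 4 * A ^ 3 + 27 * B ^ 2 ≠ 0 ∧
      ∀ y : ℝ, (m : ℝ) ^ 3 * aeval y (G.comp (X ^ 2)) =
        (k : ℝ) ^ 2 * ((y ^ 2 - s) ^ 3 + (A : ℝ) * m ^ 2 * (y ^ 2 - s) + (B : ℝ) * m ^ 3)) ∧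
    (∃ (m s k : ℚ) (A B : ℤ), m ≠ 0 ∧ k ≠ 0 ∧ 4 * A ^ 3 + 27 * B ^ 2 ≠ 0 ∧
      ∀ y : ℝ, (m : ℝ) ^ 3 * aeval y (G.comp (X ^ 2)) =
        (k : ℝ) ^ 2 * ((1 - s * y ^ 2) ^ 3 + (A : ℝ) * m ^ 2 * y ^ 4 * (1 - s * y ^ 2) +
          (B : ℝ) * m ^ 3 * y ^ 6)) :=
  Summit.KontsevichZagierPeriods.IsogenyCertificates.BiellipticRealPeriodCellStubs.IntegralModels.stub_integralModels

/-- **F — the two rule-(2) moves on a sign-half.** On a one-signed interval `(α, β)` on which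
`F = G(X²) > 0` and `dx/√F` converges: (odd) along `φ₁(y) = (y² − s)/m` the representation
`[(α,β), a₁y/√F]` exists and differs by a relation from a representation on `φ₁((α,β))` with
integrand `σ·(a₁|m|/2|k|)/√(t³ + At + B)` (`σ = ±1` the sign of the half); (even) along
`φ₂(y) = (y⁻² − s)/m` the representation `[(α,β), a₀/√F]` exists and differs by a relation from a
representation on `φ₂((α,β))` with integrand `(a₀|m|/2|k|)/√(t³ + At + B)`. -/
theorem stub_halfMoves :
    (∀ (G : ℚ[X]) (m s k : ℚ) (A B : ℤ) (a₁ σ : ℚ) (α β : ℝ), m ≠ 0 → k ≠ 0 →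
      (∀ y : ℝ, (m : ℝ) ^ 3 * aeval y (G.comp (X ^ 2)) =
        (k : ℝ) ^ 2 * ((y ^ 2 - s) ^ 3 + (A : ℝ) * m ^ 2 * (y ^ 2 - s) + (B : ℝ) * m ^ 3)) →
      α < β → Literature.ModelTheory.ExponentialFields.IsSemialgebraic ℚ {x : Fin 1 → ℝ | x 0 ∈ Ioo α β} →
      ((0 ≤ α ∧ σ = 1) ∨ (β ≤ 0 ∧ σ = -1)) →
      (∀ y ∈ Ioo α β, 0 < aeval y (G.comp (X ^ 2))) →
      IntegrableOn (fun x : Fin 1 → ℝ => 1 / Real.sqrt (aeval (x 0) (G.comp (X ^ 2)))) {x | x 0 ∈ Ioo α β} →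
      ∃ O t : KZ.IntegralRep 1,
        O.domain = {x | x 0 ∈ Ioo α β} ∧
        O.integrand = (fun x => (a₁ : ℝ) * x 0 / Real.sqrt (aeval (x 0) (G.comp (X ^ 2)))) ∧
        t.domain = {x | x 0 ∈ (fun y : ℝ => (y ^ 2 - s) / m) '' Ioo α β} ∧
        EqOn t.integrand (fun x => ((σ * a₁ * |m| / (2 * |k|) : ℚ) : ℝ) /
          Real.sqrt (x 0 ^ 3 + (A : ℝ) * x 0 + (B : ℝ))) t.domain ∧
        KZ.of O - KZ.of t ∈ KZ.relations) ∧
    (∀ (G : ℚ[X]) (m s k : ℚ) (A B : ℤ) (a₀ : ℚ) (α β : ℝ), m ≠ 0 → k ≠ 0 →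
      (∀ y : ℝ, (m : ℝ) ^ 3 * aeval y (G.comp (X ^ 2)) =
        (k : ℝ) ^ 2 * ((1 - s * y ^ 2) ^ 3 + (A : ℝ) * m ^ 2 * y ^ 4 * (1 - s * y ^ 2) +
          (B : ℝ) * m ^ 3 * y ^ 6)) →
      α < β → Literature.ModelTheory.ExponentialFields.IsSemialgebraic ℚ {x : Fin 1 → ℝ | x 0 ∈ Ioo α β} →
      (0 ≤ α ∨ β ≤ 0) →
      (∀ y ∈ Ioo α β, 0 < aeval y (G.comp (X ^ 2))) →
      IntegrableOn (fun x : Fin 1 → ℝ => 1 / Real.sqrt (aeval (x 0) (G.comp (X ^ 2)))) {x | x 0 ∈ Ioo α β} →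
      ∃ E t : KZ.IntegralRep 1,
        E.domain = {x | x 0 ∈ Ioo α β} ∧
        E.integrand = (fun x => (a₀ : ℝ) / Real.sqrt (aeval (x 0) (G.comp (X ^ 2)))) ∧
        t.domain = {x | x 0 ∈ (fun y : ℝ => ((y ^ 2)⁻¹ - s) / m) '' Ioo α β} ∧
        EqOn t.integrand (fun x => ((a₀ * |m| / (2 * |k|) : ℚ) : ℝ) /
          Real.sqrt (x 0 ^ 3 + (A : ℝ) * x 0 + (B : ℝ))) t.domain ∧
        KZ.of E - KZ.of t ∈ KZ.relations) :=
  Summit.KontsevichZagierPeriods.IsogenyCertificates.BiellipticRealPeriodCellStubs.HalfMoves.stub_halfMoves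

/-- **G — images of one-signed intervals under the two maps.** -/
theorem stub_images :
    (∀ (m s α β : ℝ), m ≠ 0 → α < β → (0 ≤ α ∨ β ≤ 0) →
      (fun y : ℝ => (y ^ 2 - s) / m) '' Ioo α β = uIoo ((α ^ 2 - s) / m) ((β ^ 2 - s) / m)) ∧
    (∀ (m s α β : ℝ), m ≠ 0 → α < β → (0 < α ∨ β < 0) →
      (fun y : ℝ => ((y ^ 2)⁻¹ - s) / m) '' Ioo α β = uIoo (((α ^ 2)⁻¹ - s) / m) (((β ^ 2)⁻¹ - s) / m)) ∧
    (∀ (m s β : ℝ), 0 < m → 0 < β →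
      (fun y : ℝ => ((y ^ 2)⁻¹ - s) / m) '' Ioo 0 β = Ioi (((β ^ 2)⁻¹ - s) / m) ∧
      (fun y : ℝ => ((y ^ 2)⁻¹ - s) / m) '' Ioo (-β) 0 = Ioi (((β ^ 2)⁻¹ - s) / m)) :=
  Summit.KontsevichZagierPeriods.IsogenyCertificates.BiellipticRealPeriodCellStubs.Images.stub_images

/-- **DE — landing of whole-component representations in the real-period cell (i).** For a
nonsingular integral `P = t³ + At + B`: a representation `[(c,d), a/√P]` on a bounded interval
between two roots on which `P > 0` (an egg), or `[(c,∞), a/√P]` on a ray from a root on which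
`P > 0` (the unbounded component), is congruent modulo `KZ.relations` to a `ℤ`-combination of
cell-(i) generators `[{P > 0}, a'/√P]`. -/
theorem stub_componentLanding :
    (∀ (A B : ℤ) (a : ℚ) (c d : ℝ) (t : KZ.IntegralRep 1), 4 * A ^ 3 + 27 * B ^ 2 ≠ 0 → c < d →
      c ^ 3 + (A : ℝ) * c + (B : ℝ) = 0 → d ^ 3 + (A : ℝ) * d + (B : ℝ) = 0 →
      (∀ y ∈ Ioo c d, 0 < y ^ 3 + (A : ℝ) * y + (B : ℝ)) →
      t.domain = {x | x 0 ∈ Ioo c d} →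
      EqOn t.integrand (fun x => (a : ℝ) / Real.sqrt (x 0 ^ 3 + (A : ℝ) * x 0 + (B : ℝ))) t.domain →
      ∃ e ∈ AddSubgroup.closure {d : KZ.FormalRep | ∃ (A B : ℤ) (a : ℚ) (r : KZ.IntegralRep 1),
          4 * A ^ 3 + 27 * B ^ 2 ≠ 0 ∧ r.domain = {x | 0 < x 0 ^ 3 + (A : ℝ) * x 0 + (B : ℝ)} ∧
          Set.EqOn r.integrand (fun x => (a : ℝ) / Real.sqrt (x 0 ^ 3 + (A : ℝ) * x 0 + (B : ℝ))) r.domain ∧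
          d = KZ.of r},
        KZ.of t - e ∈ KZ.relations) ∧
    (∀ (A B : ℤ) (a : ℚ) (c : ℝ) (t : KZ.IntegralRep 1), 4 * A ^ 3 + 27 * B ^ 2 ≠ 0 →
      c ^ 3 + (A : ℝ) * c + (B : ℝ) = 0 → (∀ y ∈ Ioi c, 0 < y ^ 3 + (A : ℝ) * y + (B : ℝ)) →
      t.domain = {x | x 0 ∈ Ioi c} →
      EqOn t.integrand (fun x => (a : ℝ) / Real.sqrt (x 0 ^ 3 + (A : ℝ) * x 0 + (B : ℝ))) t.domain →
      ∃ e ∈ AddSubgroup.closure {d : KZ.FormalRep | ∃ (A B : ℤ) (a : ℚ) (r : KZ.IntegralRep 1),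
          4 * A ^ 3 + 27 * B ^ 2 ≠ 0 ∧ r.domain = {x | 0 < x 0 ^ 3 + (A : ℝ) * x 0 + (B : ℝ)} ∧
          Set.EqOn r.integrand (fun x => (a : ℝ) / Real.sqrt (x 0 ^ 3 + (A : ℝ) * x 0 + (B : ℝ))) r.domain ∧
          d = KZ.of r},
        KZ.of t - e ∈ KZ.relations) :=
  Summit.KontsevichZagierPeriods.IsogenyCertificates.BiellipticRealPeriodCellStubs.ComponentLanding.stub_componentLanding

/-- **ASM-Sa — the generatorwise transfer from the two moves F** (registration 2; lead): given F (with
its semialgebraicity hypothesis), every bielliptic generator `[K, (a₀ + a₁x)/√G(x²)]` is congruent modulo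
`KZ.relations` to an element of the subgroup generated by the real-period cell-(i) generators. Proof =
the landed `Assembly.stub_assembly` (A, B, C, G, DE plugged in) with the semialgebraicity of the half
intervals (`r.domain`, resp. the two halves of `split_at_zero`) passed to F at its four call sites. -/
theorem stub_assembly_of_halfMovesSa :
    ((∀ (G : ℚ[X]) (m s k : ℚ) (A B : ℤ) (a₁ σ : ℚ) (α β : ℝ), m ≠ 0 → k ≠ 0 →
      (∀ y : ℝ, (m : ℝ) ^ 3 * aeval y (G.comp (X ^ 2)) =
        (k : ℝ) ^ 2 * ((y ^ 2 - s) ^ 3 + (A : ℝ) * m ^ 2 * (y ^ 2 - s) + (B : ℝ) * m ^ 3)) →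
      α < β → Literature.ModelTheory.ExponentialFields.IsSemialgebraic ℚ {x : Fin 1 → ℝ | x 0 ∈ Ioo α β} →
      ((0 ≤ α ∧ σ = 1) ∨ (β ≤ 0 ∧ σ = -1)) →
      (∀ y ∈ Ioo α β, 0 < aeval y (G.comp (X ^ 2))) →
      IntegrableOn (fun x : Fin 1 → ℝ => 1 / Real.sqrt (aeval (x 0) (G.comp (X ^ 2)))) {x | x 0 ∈ Ioo α β} →
      ∃ O t : KZ.IntegralRep 1,
        O.domain = {x | x 0 ∈ Ioo α β} ∧
        O.integrand = (fun x => (a₁ : ℝ) * x 0 / Real.sqrt (aeval (x 0) (G.comp (X ^ 2)))) ∧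
        t.domain = {x | x 0 ∈ (fun y : ℝ => (y ^ 2 - s) / m) '' Ioo α β} ∧
        EqOn t.integrand (fun x => ((σ * a₁ * |m| / (2 * |k|) : ℚ) : ℝ) /
          Real.sqrt (x 0 ^ 3 + (A : ℝ) * x 0 + (B : ℝ))) t.domain ∧
        KZ.of O - KZ.of t ∈ KZ.relations) ∧
    (∀ (G : ℚ[X]) (m s k : ℚ) (A B : ℤ) (a₀ : ℚ) (α β : ℝ), m ≠ 0 → k ≠ 0 →
      (∀ y : ℝ, (m : ℝ) ^ 3 * aeval y (G.comp (X ^ 2)) =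
        (k : ℝ) ^ 2 * ((1 - s * y ^ 2) ^ 3 + (A : ℝ) * m ^ 2 * y ^ 4 * (1 - s * y ^ 2) +
          (B : ℝ) * m ^ 3 * y ^ 6)) →
      α < β → Literature.ModelTheory.ExponentialFields.IsSemialgebraic ℚ {x : Fin 1 → ℝ | x 0 ∈ Ioo α β} →
      (0 ≤ α ∨ β ≤ 0) →
      (∀ y ∈ Ioo α β, 0 < aeval y (G.comp (X ^ 2))) →
      IntegrableOn (fun x : Fin 1 → ℝ => 1 / Real.sqrt (aeval (x 0) (G.comp (X ^ 2)))) {x | x 0 ∈ Ioo α β} →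
      ∃ E t : KZ.IntegralRep 1,
        E.domain = {x | x 0 ∈ Ioo α β} ∧
        E.integrand = (fun x => (a₀ : ℝ) / Real.sqrt (aeval (x 0) (G.comp (X ^ 2)))) ∧
        t.domain = {x | x 0 ∈ (fun y : ℝ => ((y ^ 2)⁻¹ - s) / m) '' Ioo α β} ∧
        EqOn t.integrand (fun x => ((a₀ * |m| / (2 * |k|) : ℚ) : ℝ) /
          Real.sqrt (x 0 ^ 3 + (A : ℝ) * x 0 + (B : ℝ))) t.domain ∧
        KZ.of E - KZ.of t ∈ KZ.relations)) →
    ∀ d ∈ {d : KZ.FormalRep | ∃ (G : Polynomial ℚ) (q a₀ a₁ : ℚ) (r : KZ.IntegralRep 1),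
        G.natDegree = 3 ∧ Squarefree (G.comp (Polynomial.X ^ 2)) ∧
        0 < Polynomial.aeval (q : ℝ) (G.comp (Polynomial.X ^ 2)) ∧
        Bornology.IsBounded (connectedComponentIn {y : ℝ | 0 < Polynomial.aeval y (G.comp (Polynomial.X ^ 2))} (q : ℝ)) ∧
        r.domain = {x | x 0 ∈ connectedComponentIn {y : ℝ | 0 < Polynomial.aeval y (G.comp (Polynomial.X ^ 2))} (q : ℝ)} ∧
        Set.EqOn r.integrand (fun x => ((a₀ : ℝ) + (a₁ : ℝ) * x 0) /
          Real.sqrt (Polynomial.aeval (x 0) (G.comp (Polynomial.X ^ 2)))) r.domain ∧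
        d = KZ.of r},
      ∃ e ∈ AddSubgroup.closure {d : KZ.FormalRep | ∃ (A B : ℤ) (a : ℚ) (r : KZ.IntegralRep 1),
          4 * A ^ 3 + 27 * B ^ 2 ≠ 0 ∧ r.domain = {x | 0 < x 0 ^ 3 + (A : ℝ) * x 0 + (B : ℝ)} ∧
          Set.EqOn r.integrand (fun x => (a : ℝ) / Real.sqrt (x 0 ^ 3 + (A : ℝ) * x 0 + (B : ℝ))) r.domain ∧
          d = KZ.of r},
        d - e ∈ KZ.relations :=
  Summit.KontsevichZagierPeriods.IsogenyCertificates.BiellipticRealPeriodCellStubs.Assembly.stub_assembly_of_halfMovesSa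

/-! ### Kernel transfer (proved) and the composition -/

/-- **Kernel transfer between sectors.** If every generator of `S` is congruent modulo
`KZ.relations` to an element of `closure T`, and the kernel form holds on `closure T`, then the
kernel form holds on `closure S`: for `c ∈ closure S` pick `e ∈ closure T` with `c − e ∈ relations`
(closure induction); `eval (c − e) = 0` by soundness (`KZ.relations_le_ker_eval_holds`), so
`eval c = 0` forces `eval e = 0`, `e ∈ relations`, and `c = (c − e) + e ∈ relations`. -/
theorem kernel_transfer {S T : Set KZ.FormalRep}
    (hST : ∀ d ∈ S, ∃ e ∈ AddSubgroup.closure T, d - e ∈ KZ.relations)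
    (hT : ∀ c ∈ AddSubgroup.closure T, KZ.eval c = 0 → c ∈ KZ.relations) :
    ∀ c ∈ AddSubgroup.closure S, KZ.eval c = 0 → c ∈ KZ.relations := by
  intro c hc
  have key : ∃ e ∈ AddSubgroup.closure T, c - e ∈ KZ.relations := by
    induction hc using AddSubgroup.closure_induction with
    | mem x hx => exact hST x hx
    | zero => exact ⟨0, AddSubgroup.zero_mem _, by simp [KZ.relations.zero_mem]⟩
    | add x y _ _ hx hy =>
        obtain ⟨e, he, hxe⟩ := hx
        obtain ⟨f, hf, hyf⟩ := hy
        refine ⟨e + f, AddSubgroup.add_mem _ he hf, ?_⟩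
        have : x + y - (e + f) = (x - e) + (y - f) := by abel
        rw [this]
        exact KZ.relations.add_mem hxe hyf
    | neg x _ hx =>
        obtain ⟨e, he, hxe⟩ := hx
        refine ⟨-e, AddSubgroup.neg_mem _ he, ?_⟩
        have : -x - -e = -(x - e) := by abel
        rw [this]
        exact KZ.relations.neg_mem hxe
  intro hc0
  obtain ⟨e, he, hce⟩ := key
  have h1 : KZ.eval (c - e) = 0 := AddMonoidHom.mem_ker.1 (KZ.relations_le_ker_eval_holds hce)
  have he0 : KZ.eval e = 0 := by
    rw [map_sub, hc0, zero_sub, neg_eq_zero] at h1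
    exact h1
  have hemem : e ∈ KZ.relations := hT e he he0
  have : c = (c - e) + e := by abel
  rw [this]
  exact KZ.relations.add_mem hce hemem

/-- **Composition.** F and ASM-Sa give the generatorwise transfer of the bielliptic sector into the
real-period cell (i) (A, B, C, G, DE are inside ASM-Sa, landed); `kernel_transfer` and the LANDED cell
`XMapKernelCells.realPeriodCellKernel_relations` conclude the crux `BiellipticRealPeriodCell` by name. -/
theorem BiellipticRealPeriodCell_of : BiellipticRealPeriodCell :=
  kernel_transfer (stub_assembly_of_halfMovesSa stub_halfMoves)
    Summit.KontsevichZagierPeriods.IsogenyCertificates.XMapKernelCells.realPeriodCellKernel_relations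

end Summit.KontsevichZagierPeriods.KontsevichZagierPeriods.Cruxes.BiellipticRealPeriodCell.Lines.Sketch

end
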